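import Mathlib
import HarnessLib
import Summits.NavierStokesRegularity.NavierStokesRegularity.Theorems.TypeIQuarterGateScarEnvelopeTypeIForcedTsaiExactSwirlTail

/-!
# ARM B — DATUM B-2j CORRECTION / B-2m, kernel part (K1b): NO registered witness has an EXACTLY
  `(−1)`-homogeneous SWIRL tail — the obstruction already at LINEAR order
  (ns-wall-extremal, eng-1 lineage g6, 2026-08-29)

WHAT IS PROVED (theorem-only; standard axioms).  `V_e(y) = (‖y‖²)⁻¹ • (y × e)` is the exact swirl
tail of `…ForcedTsaiExactSwirlTail` (K1a: linearised residual `2(‖x‖²)^{−2}(x × e)`, self-advection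
`(‖x‖²)^{−2}(⟪e,x⟫e − ‖e‖²x)`).  Here, for `x ≠ 0`:
* `curl_cross_const` : `curl (y ↦ y × e) = −2e`; `cross_self_cross` : `x × (x × e) = ⟪e,x⟫x − ‖x‖²e`;
* `curl_linearisedResidualField` : `curl[2(‖y‖²)^{−2}(y × e)](x) = 4(‖x‖²)^{−2}e − 8⟪e,x⟫(‖x‖²)^{−3}x`,
  whose norm is EXACTLY `4‖e‖/‖x‖⁴` (`norm_curl_linearisedResidual_swirlTail`);
* `curl_convectField` : `curl[(‖y‖²)^{−2}(⟪e,y⟫e − ‖e‖²y)](x) = 4⟪e,x⟫(‖x‖²)^{−3}(e × x)`;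
* ★★ `lerayVorticityResidual_swirlTail` : the REGISTERED vorticity residual of `…ForcedTsaiDefs`
  (`g = curl(−ΔU + ½U + ½DU·y + (U·∇)U)`) of the swirl tail is
  `g(x) = 4(‖x‖²)^{−2}e − 8⟪e,x⟫(‖x‖²)^{−3}x + 4⟪e,x⟫(‖x‖²)^{−3}(e × x)` exactly;
* ★ `norm_lerayVorticityResidual_swirlTail_ge` : `‖g(x)‖ ≥ 4‖e‖/‖x‖⁴` at EVERY `x ≠ 0` (the
  self-advection part is orthogonal to the linear part);
* ★★ `not_integrable_residual_of_swirlTail` : if `U : ℝ³ → ℝ³` COINCIDES WITH `V_e` (`e ≠ 0`)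
  OUTSIDE SOME BALL then `y ↦ (1+‖y‖)⁵‖g_U(y)‖²` is NOT integrable (density `≥ 16‖e‖²/‖y‖³`; the
  dyadic-shell argument of p694942 `…StokesletTailObstruction` verbatim, same cone bookkeeping);
* `not_forcedTsaiWitness_of_swirlTail` / `not_forcedTsaiTypeIWitness_of_swirlTail` : hence such a
  `U` never satisfies the witness clause of `ForcedTsaiModulusLE M δ`, nor of the repaired Type-I
  currency `ForcedTsaiModulusTypeILE C₀ M δ`, for any parameters and whatever its core.

MEANING (HOME/ARM-B/swirltail-eng1g6/B2J-CORRECTION.md §0/§2/§5; DATUM B-2m of ns-wall-eng-2 g2;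
ns-wall-crit-1 g4 04:23:48Z (ii); idea-crit-7 g6 L6 (C) 04:25:37Z).  The swirl twin of the
Stokeslet obstruction p694942 — but failing one order EARLIER: the Stokeslet is an exact LINEAR
zero mode and fails the registered currency only through its self-advection, while the exactly
homogeneous swirl tail fails already through `curl(−ΔV_e) = 4e/|y|⁴ − 8⟨e,y⟩y/|y|⁶`.  The admissible
swirl tails of the registered class are the companion-corrected decaying modes
`χ_dec(|y|)(y × ∇P_J)`, `χ_dec ~ |y|^{−J−1}(1 + J(J+1)|y|⁻² + …)` (B-2m FACT 1; elementary for even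
`J`) — a statement about CONTINUING a field homogeneously, not about swirl sectors, whose
registered linear floors are 18.903 / 34.766 / 56.680 (B-2j v5).  HONEST FRAME: a statement about
the CURRENCY; it excludes no near-profile with a corrected tail, bounds no modulus, and says nothing
about Navier–Stokes regularity.  Crux `ScarEnvelopeTypeI` (stmt-23843) / wall H3 OPEN.
-/

noncomputable section

set_option linter.dupNamespace false

namespace Summit.NavierStokesRegularity.NavierStokesRegularity.Cruxes.ScarEnvelopeTypeI.ForcedTsai

namespace SwirlTail

open scoped Laplacian RealInnerProductSpace InnerProductSpace Pointwise
open Literature.Analysis.FluidPDE Literature.Analysis.PDE Set Filter Topology MeasureTheory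

/-! ## Curls of the two explicit residual fields -/

/-- The BAC–CAB identity `x × (x × e) = ⟪e, x⟫ x − ‖x‖² e`. -/
theorem cross_self_cross (x e : E3) : cross x (cross x e) = ⟪e, x⟫ • x - (‖x‖ ^ 2) • e := by
  have hI : ∀ a b : E3, ⟪a, b⟫ = a 0 * b 0 + a 1 * b 1 + a 2 * b 2 := fun a b => by
    simp [EuclideanSpace.inner_eq_star_dotProduct, dotProduct, Fin.sum_univ_three, mul_comm]
  rw [← real_inner_self_eq_norm_sq, hI, hI]
  ext i
  fin_cases i <;> simp [cross, cross_apply] <;> ring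

/-- `⟪x, c • (e × x)⟫ = 0`. -/
theorem inner_smul_cross_self (e x : E3) (c : ℝ) : ⟪x, c • cross e x⟫ = 0 := by
  rw [cross_swap, smul_neg, inner_neg_right, inner_self_smul_cross, neg_zero]

/-- **`curl (y ↦ y × e) = −2e`** (the linear swirl generator has constant vorticity `−2e`). -/
theorem curl_cross_const (e x : E3) : curl (fun y : E3 => cross y e) x = -((2 : ℝ) • e) := by
  rw [curl_eq_curlCLM, cross_const_eq_flip,
    show (fun y : E3 => (crossCLM.flip e) y) = ⇑(crossCLM.flip e) from rfl, (crossCLM.flip e).fderiv,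
    curlCLM_apply]
  ext i
  fin_cases i <;> simp [cross, cross_apply] <;> ring

/-- A rank-one operator with a rescaled functional: `(c • ℓ) ⊗ v = c • (ℓ ⊗ v)`. -/
theorem smulRight_smul_left (c : ℝ) (ℓ : E3 →L[ℝ] ℝ) (v : E3) :
    (c • ℓ).smulRight v = c • ℓ.smulRight v := by
  ext w
  simp [mul_smul]

/-- **Curl of the linearised residual field** `y ↦ 2(‖y‖²)^{−2}(y × e)`: for `x ≠ 0`,
`curl = 4(‖x‖²)^{−2} e − 8⟪e,x⟫(‖x‖²)^{−3} x` — of norm EXACTLY `4‖e‖/‖x‖⁴`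
(`norm_curl_linearisedResidual_swirlTail`). -/
theorem curl_linearisedResidualField (e : E3) {x : E3} (hx : x ≠ 0) :
    curl (fun y : E3 => (2 * (‖y‖ ^ 2) ^ (-(2 : ℝ))) • cross y e) x
      = (4 * (‖x‖ ^ 2) ^ (-(2 : ℝ))) • e - (8 * ⟪e, x⟫ * (‖x‖ ^ 2) ^ (-(3 : ℝ))) • x := by
  have hr : ‖x‖ ≠ 0 := norm_ne_zero_iff.mpr hx
  have hφ : HasFDerivAt (fun y : E3 => 2 * (‖y‖ ^ 2) ^ (-(2 : ℝ)))
      ((2 : ℝ) • ((2 * (-(2 : ℝ)) * (‖x‖ ^ 2) ^ (-(2 : ℝ) - 1)) • innerSL ℝ x)) x :=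
    (hasFDerivAt_norm_sq_rpow (-(2 : ℝ)) hx).const_mul 2
  have hf : DifferentiableAt ℝ (fun y : E3 => cross y e) x := by
    rw [cross_const_eq_flip]; exact (crossCLM.flip e).differentiableAt
  rw [curl_smul hφ.differentiableAt hf, curl_cross_const, hφ.fderiv, smul_smul, smulRight_smul_left,
    map_smul, curlCLM_smulRight_innerSL, cross_self_cross]
  have e4 : (‖x‖ ^ 2) ^ (-(2 : ℝ)) = (‖x‖⁻¹) ^ 4 := norm_sq_rpow_eq_inv_pow hx (by norm_num)
  have e6 : (‖x‖ ^ 2) ^ (-(2 : ℝ) - 1) = (‖x‖⁻¹) ^ 6 := norm_sq_rpow_eq_inv_pow hx (by norm_num)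
  have e6' : (‖x‖ ^ 2) ^ (-(3 : ℝ)) = (‖x‖⁻¹) ^ 6 := norm_sq_rpow_eq_inv_pow hx (by norm_num)
  rw [e4, e6, e6']
  match_scalars <;> field_simp <;> ring

/-- **Curl of the self-advection field** `y ↦ (‖y‖²)^{−2}(⟪e,y⟫ e − ‖e‖² y)`: for `x ≠ 0`,
`curl = 4⟪e,x⟫(‖x‖²)^{−3} (e × x)` (the radial part `‖e‖²(‖y‖²)^{−2} y` is curl free). -/
theorem curl_convectField (e : E3) {x : E3} (hx : x ≠ 0) :
    curl (fun y : E3 => (⟪e, y⟫ * (‖y‖ ^ 2) ^ (-(2 : ℝ))) • e - (‖e‖ ^ 2 * (‖y‖ ^ 2) ^ (-(2 : ℝ))) • y) x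
      = (4 * ⟪e, x⟫ * (‖x‖ ^ 2) ^ (-(3 : ℝ))) • cross e x := by
  have hr : ‖x‖ ≠ 0 := norm_ne_zero_iff.mpr hx
  have hB := hasFDerivAt_selfAdvection_coeffB e hx
  have hC : HasFDerivAt (fun y : E3 => ‖e‖ ^ 2 * (‖y‖ ^ 2) ^ (-(2 : ℝ)))
      (innerSL ℝ ((‖e‖ ^ 2 * (2 * (-(2 : ℝ)) * (‖x‖ ^ 2) ^ (-(2 : ℝ) - 1))) • x)) x := by
    have h := (hasFDerivAt_norm_sq_rpow (-(2 : ℝ)) hx).const_mul (‖e‖ ^ 2)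
    refine h.congr_fderiv ?_
    rw [map_smul, smul_smul]
  have hdB : DifferentiableAt ℝ (fun y : E3 => (⟪e, y⟫ * (‖y‖ ^ 2) ^ (-(2 : ℝ))) • e) x :=
    hB.differentiableAt.smul (differentiableAt_const e)
  have hdC : DifferentiableAt ℝ (fun y : E3 => (‖e‖ ^ 2 * (‖y‖ ^ 2) ^ (-(2 : ℝ))) • y) x :=
    hC.differentiableAt.smul differentiableAt_id
  have hxx : cross x x = 0 := by simp [cross]
  have hee : cross e e = 0 := by simp [cross]
  rw [curl_sub hdB hdC, curl_smul_const' hB.differentiableAt e, curl_smul_id hC.differentiableAt,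
    gradient_eq_of_hasFDerivAt_innerSL hB, gradient_eq_of_hasFDerivAt_innerSL hC,
    cross_add_smul_left, hee, smul_zero, add_zero, ← crossCLM_apply (_ • x) x, map_smul,
    smul_apply, crossCLM_apply, hxx, smul_zero, sub_zero, cross_swap x e, smul_neg, ← neg_smul]
  have e6 : (‖x‖ ^ 2) ^ (-(2 : ℝ) - 1) = (‖x‖⁻¹) ^ 6 := norm_sq_rpow_eq_inv_pow hx (by norm_num)
  have e6' : (‖x‖ ^ 2) ^ (-(3 : ℝ)) = (‖x‖⁻¹) ^ 6 := norm_sq_rpow_eq_inv_pow hx (by norm_num)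
  rw [e6, e6']
  congr 1
  ring

/-! ## The registered vorticity residual of the swirl tail -/

/-- ★★ **The registered vorticity residual of the exact swirl tail** (`…ForcedTsaiDefs`,
`g = curl(−ΔU + ½U + ½DU·y + (U·∇)U)`): for `x ≠ 0`,
`g(x) = 4(‖x‖²)^{−2} e − 8⟪e,x⟫(‖x‖²)^{−3} x + 4⟪e,x⟫(‖x‖²)^{−3} (e × x)`.
The first two terms come from the LINEAR part (already non-zero: the swirl tail fails the
registered currency at linear order, unlike the Stokeslet p694429), the last from self-advection. -/
theorem lerayVorticityResidual_swirlTail (e : E3) {x : E3} (hx : x ≠ 0) :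
    lerayVorticityResidual (fun y : E3 => (‖y‖ ^ 2) ^ (-(1 : ℝ)) • cross y e) x
      = (4 * (‖x‖ ^ 2) ^ (-(2 : ℝ))) • e - (8 * ⟪e, x⟫ * (‖x‖ ^ 2) ^ (-(3 : ℝ))) • x
        + (4 * ⟪e, x⟫ * (‖x‖ ^ 2) ^ (-(3 : ℝ))) • cross e x := by
  set U : E3 → E3 := fun y : E3 => (‖y‖ ^ 2) ^ (-(1 : ℝ)) • cross y e with hU
  have hne : ∀ᶠ y in 𝓝 x, y ≠ (0 : E3) := eventually_ne_nhds hx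
  -- the momentum residual, pointwise off the origin
  have hres : lerayMomentumResidual U =ᶠ[𝓝 x] fun y : E3 =>
      (2 * (‖y‖ ^ 2) ^ (-(2 : ℝ))) • cross y e
        + ((⟪e, y⟫ * (‖y‖ ^ 2) ^ (-(2 : ℝ))) • e - (‖e‖ ^ 2 * (‖y‖ ^ 2) ^ (-(2 : ℝ))) • y) := by
    refine hne.mono fun y hy => ?_
    have h1 : -((Δ U) y) + (1 / 2 : ℝ) • U y + (1 / 2 : ℝ) • fderiv ℝ U y y
        = (2 * (‖y‖ ^ 2) ^ (-(2 : ℝ))) • cross y e := swirlTail_linearisedResidual e hy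
    have h2 := convect_swirlTail e hy
    rw [← hU] at h2
    rw [lerayMomentumResidual, h1, h2]
  have hdL : DifferentiableAt ℝ (fun y : E3 => (2 * (‖y‖ ^ 2) ^ (-(2 : ℝ))) • cross y e) x := by
    have hf : DifferentiableAt ℝ (fun y : E3 => cross y e) x := by
      rw [cross_const_eq_flip]; exact (crossCLM.flip e).differentiableAt
    exact (((hasFDerivAt_norm_sq_rpow (-(2 : ℝ)) hx).const_mul 2).differentiableAt).smul hf
  have hdN : DifferentiableAt ℝ (fun y : E3 =>
      (⟪e, y⟫ * (‖y‖ ^ 2) ^ (-(2 : ℝ))) • e - (‖e‖ ^ 2 * (‖y‖ ^ 2) ^ (-(2 : ℝ))) • y) x :=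
    ((hasFDerivAt_selfAdvection_coeffB e hx).differentiableAt.smul (differentiableAt_const e)).sub
      ((((hasFDerivAt_norm_sq_rpow (-(2 : ℝ)) hx).const_mul (‖e‖ ^ 2)).differentiableAt).smul
        differentiableAt_id)
  rw [lerayVorticityResidual, curl_eq_curlCLM, hres.fderiv_eq, ← curl_eq_curlCLM, curl_add hdL hdN,
    curl_linearisedResidualField e hx, curl_convectField e hx]

/-- **The linear part of the residual has norm exactly `4‖e‖/‖x‖⁴`** at every `x ≠ 0`:
`‖4(‖x‖²)^{−2} e − 8⟪e,x⟫(‖x‖²)^{−3} x‖ = 4‖e‖‖x‖⁻⁴` (the cross term and the `x`-term square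
cancel exactly). -/
theorem norm_curl_linearisedResidual_swirlTail (e : E3) {x : E3} (hx : x ≠ 0) :
    ‖(4 * (‖x‖ ^ 2) ^ (-(2 : ℝ))) • e - (8 * ⟪e, x⟫ * (‖x‖ ^ 2) ^ (-(3 : ℝ))) • x‖
      = 4 * ‖e‖ * (‖x‖⁻¹) ^ 4 := by
  have hr : ‖x‖ ≠ 0 := norm_ne_zero_iff.mpr hx
  have e4 : (‖x‖ ^ 2) ^ (-(2 : ℝ)) = (‖x‖⁻¹) ^ 4 := norm_sq_rpow_eq_inv_pow hx (by norm_num)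
  have e6 : (‖x‖ ^ 2) ^ (-(3 : ℝ)) = (‖x‖⁻¹) ^ 6 := norm_sq_rpow_eq_inv_pow hx (by norm_num)
  rw [e4, e6]
  have hsq : ‖(4 * (‖x‖⁻¹) ^ 4) • e - (8 * ⟪e, x⟫ * (‖x‖⁻¹) ^ 6) • x‖ ^ 2
      = (4 * ‖e‖ * (‖x‖⁻¹) ^ 4) ^ 2 := by
    rw [@norm_sub_sq_real, norm_smul, norm_smul, inner_smul_left, inner_smul_right, Real.norm_eq_abs,
      Real.norm_eq_abs, mul_pow, mul_pow, sq_abs, sq_abs, real_inner_comm x e]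
    simp only [conj_trivial]
    field_simp
    ring
  have h1 : 0 ≤ ‖(4 * (‖x‖⁻¹) ^ 4) • e - (8 * ⟪e, x⟫ * (‖x‖⁻¹) ^ 6) • x‖ := norm_nonneg _
  have h2 : 0 ≤ 4 * ‖e‖ * (‖x‖⁻¹) ^ 4 := by positivity
  nlinarith [hsq, h1, h2]

/-- ★ **Pointwise lower bound, everywhere off the origin**: `‖g(x)‖ ≥ 4‖e‖/‖x‖⁴` for the registered
vorticity residual `g` of the exact swirl tail (the linear part is orthogonal to the self-advection
part `∝ e × x`, so the latter only adds). -/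
theorem norm_lerayVorticityResidual_swirlTail_ge (e : E3) {x : E3} (hx : x ≠ 0) :
    4 * ‖e‖ * (‖x‖⁻¹) ^ 4 ≤
      ‖lerayVorticityResidual (fun y : E3 => (‖y‖ ^ 2) ^ (-(1 : ℝ)) • cross y e) x‖ := by
  rw [lerayVorticityResidual_swirlTail e hx, ← norm_curl_linearisedResidual_swirlTail e hx]
  set A : E3 := (4 * (‖x‖ ^ 2) ^ (-(2 : ℝ))) • e - (8 * ⟪e, x⟫ * (‖x‖ ^ 2) ^ (-(3 : ℝ))) • x with hA
  set B : E3 := (4 * ⟪e, x⟫ * (‖x‖ ^ 2) ^ (-(3 : ℝ))) • cross e x with hB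
  have horth : ⟪A, B⟫ = 0 := by
    rw [hA, hB, inner_sub_left, inner_smul_left, inner_smul_left]
    have h1 : ⟪e, (4 * ⟪e, x⟫ * (‖x‖ ^ 2) ^ (-(3 : ℝ))) • cross e x⟫ = 0 := inner_self_smul_cross e x _
    have h2 : ⟪x, (4 * ⟪e, x⟫ * (‖x‖ ^ 2) ^ (-(3 : ℝ))) • cross e x⟫ = 0 := inner_smul_cross_self e x _
    rw [h1, h2]; simp
  have hsq : ‖A + B‖ ^ 2 = ‖A‖ ^ 2 + ‖B‖ ^ 2 := by
    rw [@norm_add_sq_real, horth]; ring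
  have hle : ‖A‖ ^ 2 ≤ ‖A + B‖ ^ 2 := by rw [hsq]; nlinarith [sq_nonneg ‖B‖]
  exact (pow_le_pow_iff_left₀ (norm_nonneg A) (norm_nonneg (A + B)) two_ne_zero).mp hle

/-! ## Non-integrability of the weighted residual density -/

/-- ★★ **EXACT-SWIRL-TAIL OBSTRUCTION.** If a field `U : ℝ³ → ℝ³` coincides with the exact swirl tail
`V_e(y) = (‖y‖²)⁻¹(y × e)`, `e ≠ 0`, outside some ball, then its registered residual density
`(1+‖y‖)⁵‖g(y)‖²` is NOT integrable: it is `≥ 16‖e‖²/‖y‖³` there (bound valid at EVERY point; the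
dyadic-shell bookkeeping on the `30°–60°` cone of p694942 is reused verbatim), and the dyadic shells
all carry the same mass.  Unlike the Stokeslet (p694942, which fails only through its self-advection),
the swirl tail fails already through its LINEAR residual `2(y×e)/|y|⁴` — the kernel face of «no
EXACTLY (−1)-homogeneous zero-residual exterior tail in a swirl sector» (B-2j §3 narrowed; the
admissible swirl tails carry the `|y|⁻³` companion of DATUM B-2m). -/
theorem not_integrable_residual_of_swirlTail {U : E3 → E3} {e : E3} (he : e ≠ 0) {R : ℝ}
    (hU : ∀ y : E3, R < ‖y‖ → U y = (‖y‖ ^ 2) ^ (-(1 : ℝ)) • cross y e) :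
    ¬ Integrable (fun y : E3 => (1 + ‖y‖) ^ 5 * ‖lerayVorticityResidual U y‖ ^ 2) := by
  intro hint
  set S : Set E3 := {y : E3 | ‖e‖ * ‖y‖ < 2 * ⟪e, y⟫ ∧ ‖e‖ * ‖y‖ < 2 * ‖cross e y‖} with hS
  set F : E3 → ℝ := fun y => (1 + ‖y‖) ^ 5 * ‖lerayVorticityResidual U y‖ ^ 2 with hF
  set ρ : ℝ := max R 1 + 1 with hρdef
  have hρR : R < ρ := by rw [hρdef]; linarith [le_max_left R 1]
  have hρ1 : 1 ≤ ρ := by rw [hρdef]; linarith [le_max_right R 1]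
  have hρ : 0 < ρ := by linarith
  set A : ℕ → Set E3 := fun k => S ∩ {y : E3 | (2 : ℝ) ^ k * ρ ≤ ‖y‖ ∧ ‖y‖ < (2 : ℝ) ^ (k + 1) * ρ}
    with hA
  -- (1) the residual of `U` agrees with the swirl-tail residual outside the ball
  have hres : ∀ y : E3, R < ‖y‖ → lerayVorticityResidual U y = lerayVorticityResidual
      (fun z : E3 => (‖z‖ ^ 2) ^ (-(1 : ℝ)) • cross z e) y := by
    intro y hy
    apply lerayVorticityResidual_congr
    have hopen : IsOpen {z : E3 | R < ‖z‖} := isOpen_lt continuous_const continuous_norm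
    filter_upwards [hopen.mem_nhds hy] with z hz using hU z hz
  -- (2) pointwise lower bound on the shells: F ≥ 16‖e‖² / (2^{k+1} ρ)^3 on A k
  have hlow : ∀ k : ℕ, ∀ y ∈ A k, 16 * ‖e‖ ^ 2 * (((2 : ℝ) ^ (k + 1) * ρ)⁻¹) ^ 3 ≤ F y := by
    intro k y hy
    obtain ⟨-, hlo, hhi⟩ := hy
    have h2k : (1 : ℝ) ≤ (2 : ℝ) ^ k := one_le_pow₀ (by norm_num)
    have hy1 : 1 ≤ ‖y‖ := le_trans (by nlinarith) hlo
    have hy0 : y ≠ 0 := by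
      intro h; rw [h, norm_zero] at hy1; linarith
    have hyR : R < ‖y‖ := lt_of_lt_of_le (by nlinarith) hlo
    have hr : 0 < ‖y‖ := by linarith
    have hg := norm_lerayVorticityResidual_swirlTail_ge e hy0
    rw [← hres y hyR] at hg
    have hg2 : (4 * ‖e‖ * (‖y‖⁻¹) ^ 4) ^ 2 ≤ ‖lerayVorticityResidual U y‖ ^ 2 :=
      pow_le_pow_left₀ (by positivity) hg 2
    have h5 : ‖y‖ ^ 5 ≤ (1 + ‖y‖) ^ 5 := pow_le_pow_left₀ hr.le (by linarith) 5
    have hyhi : (((2 : ℝ) ^ (k + 1) * ρ)⁻¹) ≤ ‖y‖⁻¹ := by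
      rw [inv_le_inv₀ (by positivity) hr]; exact hhi.le
    calc 16 * ‖e‖ ^ 2 * (((2 : ℝ) ^ (k + 1) * ρ)⁻¹) ^ 3
        ≤ 16 * ‖e‖ ^ 2 * (‖y‖⁻¹) ^ 3 := by gcongr
      _ = ‖y‖ ^ 5 * (4 * ‖e‖ * (‖y‖⁻¹) ^ 4) ^ 2 := by field_simp; ring
      _ ≤ (1 + ‖y‖) ^ 5 * ‖lerayVorticityResidual U y‖ ^ 2 :=
          mul_le_mul h5 hg2 (by positivity) (by positivity)
  -- (3) the shells are measurable, pairwise disjoint, and `A k = 2^k • A 0`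
  have hSopen : IsOpen S := isOpen_stokesletCone e
  have hAmeas : ∀ k, MeasurableSet (A k) := by
    intro k
    refine hSopen.measurableSet.inter ?_
    exact (measurableSet_le measurable_const measurable_norm).inter
      (measurableSet_lt measurable_norm measurable_const)
  have hAdisj : Pairwise (Function.onFun Disjoint A) := by
    intro i j hij
    rw [Function.onFun, Set.disjoint_left]
    rintro y ⟨-, hi1, hi2⟩ ⟨-, hj1, hj2⟩
    rcases lt_or_gt_of_ne hij with h | h
    · have : (2 : ℝ) ^ (i + 1) * ρ ≤ (2 : ℝ) ^ j * ρ := by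
        gcongr
        · norm_num
        · omega
      linarith
    · have : (2 : ℝ) ^ (j + 1) * ρ ≤ (2 : ℝ) ^ i * ρ := by
        gcongr
        · norm_num
        · omega
      linarith
  have hA0 : A 0 = S ∩ {y : E3 | ρ ≤ ‖y‖ ∧ ‖y‖ < 2 * ρ} := by
    ext y
    simp only [hA, mem_inter_iff, mem_setOf_eq, pow_zero, one_mul, zero_add, pow_one]
  have hAk : ∀ k, volume (A k) = ENNReal.ofReal ((8 : ℝ) ^ k) * volume (A 0) := by
    intro k
    have h := stokesletCone_shell_eq_smul e ρ k
    rw [← hS] at h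
    have h8 : |((2 : ℝ) ^ k) ^ Module.finrank ℝ E3| = (8 : ℝ) ^ k := by
      rw [finrank_euclideanSpace_fin, abs_of_pos (by positivity), ← pow_mul, mul_comm, pow_mul]
      norm_num
    rw [hA0, show A k = S ∩ {y : E3 | (2 : ℝ) ^ k * ρ ≤ ‖y‖ ∧ ‖y‖ < (2 : ℝ) ^ (k + 1) * ρ} from rfl,
      h, Measure.addHaar_smul, h8]
  -- (4) the first shell has positive measure (it contains an open non-empty set)
  have hA0pos : 0 < volume (A 0) := by
    obtain ⟨y₀, hy₀0, hy₀S⟩ := stokesletCone_nonempty he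
    have hn0 : 0 < ‖y₀‖ := norm_pos_iff.mpr hy₀0
    set t : ℝ := (3 * ρ / 2) / ‖y₀‖ with ht
    have htpos : 0 < t := by positivity
    have hy₁S : t • y₀ ∈ S := (smul_mem_stokesletCone_iff e htpos y₀).mpr hy₀S
    have hy₁n : ‖t • y₀‖ = 3 * ρ / 2 := by
      rw [norm_smul, Real.norm_eq_abs, abs_of_pos htpos, ht, div_mul_cancel₀ _ hn0.ne']
    have hO : IsOpen (S ∩ {y : E3 | ρ < ‖y‖ ∧ ‖y‖ < 2 * ρ}) :=
      hSopen.inter ((isOpen_lt continuous_const continuous_norm).inter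
        (isOpen_lt continuous_norm continuous_const))
    have hsub : S ∩ {y : E3 | ρ < ‖y‖ ∧ ‖y‖ < 2 * ρ} ⊆ A 0 := by
      rintro y ⟨hyS, h1, h2⟩
      refine ⟨hyS, ?_, ?_⟩
      · simp only [pow_zero, one_mul]; exact h1.le
      · simpa [zero_add, pow_one] using h2
    have hne : (S ∩ {y : E3 | ρ < ‖y‖ ∧ ‖y‖ < 2 * ρ}).Nonempty :=
      ⟨t • y₀, hy₁S, by rw [mem_setOf_eq, hy₁n]; constructor <;> linarith⟩
    exact lt_of_lt_of_le (hO.measure_pos volume hne) (measure_mono hsub)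
  -- (5) every shell carries lintegral mass ≥ a := ofReal(16‖e‖²/(8ρ³)) · vol(A 0)
  set a : ENNReal := ENNReal.ofReal (16 * ‖e‖ ^ 2 * (8 * ρ ^ 3)⁻¹) * volume (A 0) with ha
  have hapos : 0 < a := by
    have : 0 < 16 * ‖e‖ ^ 2 * (8 * ρ ^ 3)⁻¹ := by
      have := norm_pos_iff.mpr he; positivity
    exact ENNReal.mul_pos (ENNReal.ofReal_pos.mpr this).ne' hA0pos.ne'
  have hshell : ∀ k, a ≤ ∫⁻ y in A k, ENNReal.ofReal (F y) := by
    intro k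
    have h8 : ((2 : ℝ) ^ (k + 1)) ^ 3 = 8 * 8 ^ k := by
      rw [← pow_mul, mul_comm, pow_mul, pow_succ, mul_comm]
      norm_num
    calc a = ENNReal.ofReal (16 * ‖e‖ ^ 2 * (((2 : ℝ) ^ (k + 1) * ρ)⁻¹) ^ 3) * volume (A k) := by
          rw [ha, hAk k, ← mul_assoc, ← ENNReal.ofReal_mul (by positivity)]
          congr 2
          rw [inv_pow, mul_pow, h8]
          field_simp
      _ = ∫⁻ y in A k, ENNReal.ofReal (16 * ‖e‖ ^ 2 * (((2 : ℝ) ^ (k + 1) * ρ)⁻¹) ^ 3) := by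
          rw [setLIntegral_const]
      _ ≤ ∫⁻ y in A k, ENNReal.ofReal (F y) :=
          setLIntegral_mono' (hAmeas k) fun y hy => ENNReal.ofReal_le_ofReal (hlow k y hy)
  -- (6) summing N shells gives N·a ≤ ∫⁻ F < ∞ for every N: contradiction
  have hfin : ∫⁻ y, ENNReal.ofReal (F y) < ⊤ := hint.lintegral_lt_top
  have hNa : ∀ N : ℕ, (N : ENNReal) * a ≤ ∫⁻ y, ENNReal.ofReal (F y) := by
    intro N
    calc (N : ENNReal) * a = ∑ k ∈ Finset.range N, a := by
          rw [Finset.sum_const, Finset.card_range, nsmul_eq_mul]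
      _ ≤ ∑ k ∈ Finset.range N, ∫⁻ y in A k, ENNReal.ofReal (F y) :=
          Finset.sum_le_sum fun k _ => hshell k
      _ = ∫⁻ y in ⋃ k ∈ Finset.range N, A k, ENNReal.ofReal (F y) := by
          rw [lintegral_biUnion_finset (fun i _ j _ hij => hAdisj hij) (fun k _ => hAmeas k)]
      _ ≤ ∫⁻ y, ENNReal.ofReal (F y) := by
          rw [← setLIntegral_univ (μ := volume) (fun y => ENNReal.ofReal (F y))]
          exact lintegral_mono_set (subset_univ _)
  obtain ⟨N, hN⟩ := ENNReal.exists_nat_mul_gt hapos.ne' hfin.ne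
  exact absurd (lt_of_lt_of_le hN (hNa N)) (lt_irrefl _)

/-- COROLLARY (typed, registered currency): a field with an exact swirl tail `(y × e)/|y|²`,
`e ≠ 0`, outside some ball is never a witness of `ForcedTsaiModulusLE M δ` — the integrability
clause of the registered currency fails, whatever the core and whatever `M`, `δ`. -/
theorem not_forcedTsaiWitness_of_swirlTail {U : E3 → E3} {e : E3} (he : e ≠ 0) {R : ℝ}
    (hU : ∀ y : E3, R < ‖y‖ → U y = (‖y‖ ^ 2) ^ (-(1 : ℝ)) • cross y e) (M δ : ℝ) :
    ¬ (ContDiff ℝ ((⊤ : ℕ∞) : WithTop ℕ∞) U ∧ VectorCalculus.IsDivFree U ∧ M ≤ lerayLevel U ∧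
        Integrable (fun y => (1 + ‖y‖) ^ 5 * ‖lerayVorticityResidual U y‖ ^ 2) ∧
        lerayResidualNorm U ≤ δ) :=
  fun h => not_integrable_residual_of_swirlTail he hU h.2.2.2.1

/-- The same in the REPAIRED Type-I currency `ForcedTsaiModulusTypeILE C₀ M δ` (crc-p2 g6 R3,
`…ForcedTsaiTypeIDefs`): the decay clause `‖U y‖ ≤ C₀/(1+‖y‖)` is satisfiable by such a `U`
(`|V_e(y)| ≤ ‖e‖/‖y‖`), but the integrability clause is not — so no row of the Type-I currency has
an exactly homogeneous swirl tail either. -/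
theorem not_forcedTsaiTypeIWitness_of_swirlTail {U : E3 → E3} {e : E3} (he : e ≠ 0) {R : ℝ}
    (hU : ∀ y : E3, R < ‖y‖ → U y = (‖y‖ ^ 2) ^ (-(1 : ℝ)) • cross y e) (C₀ M δ : ℝ) :
    ¬ (ContDiff ℝ ((⊤ : ℕ∞) : WithTop ℕ∞) U ∧ VectorCalculus.IsDivFree U ∧
        (∀ y, ‖U y‖ ≤ C₀ / (1 + ‖y‖)) ∧ M ≤ lerayLevel U ∧
        Integrable (fun y => (1 + ‖y‖) ^ 5 * ‖lerayVorticityResidual U y‖ ^ 2) ∧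
        lerayResidualNorm U ≤ δ) :=
  fun h => not_integrable_residual_of_swirlTail he hU h.2.2.2.2.1

end SwirlTail

end Summit.NavierStokesRegularity.NavierStokesRegularity.Cruxes.ScarEnvelopeTypeI.ForcedTsai

end
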